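import Summits.BirchSwinnertonDyer.BirchSwinnertonDyer.Theorems.InertBadSignedBranchesInertBadAtThreeIstarZeroEtaMCPair
import Summits.BirchSwinnertonDyer.BirchSwinnertonDyer.Theorems.InertBadSignedBranchesCccOneLawOnTypeIstarZeroOfLowerHalf
import Summits.BirchSwinnertonDyer.Rank1Residual.Additive.QuadraticBranchOddStrictExactControlDischarge
import Summits.BirchSwinnertonDyer.BirchSwinnertonDyer.Theorems.InertBadSignedBranchesCccOneLawOnTypeIstarZeroOfKMCPerrinRiou
import Summits.BirchSwinnertonDyer.BirchSwinnertonDyer.Theorems.InertBadSignedBranchesKFormConsumers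
import HarnessLib

/-!
# Route `InertBadSignedBranches` (rung K8, rev 4), crux 19223 `CccOneLawOnTypeIstarZero`: the CONVERSE
# direction «`BSD(W, p)` ⟹ C-cc-1 at `(W, p)`» in Kobayashi's (K)-FORM — no `ℚ(√p*)`-subtower main
# conjecture anywhere —, hence «crux ⟺ `BSD_p` on the type» modulo the route's POST-D92 support items
# {`PlusMCEtaK`, `SignedReadingFacts`, `PublishedFactsInert`}, and the Kato–Perrin-Riou road re-based on
# them (helper `--supports` 19223; cell bsd-cm, seat bsd-cm-k8i-c2 g4; nothing asserted)

State of the kernel on the type `(p, I₀*)`, `p ≥ 5`: the crux C-cc-1 and `BSD_p` are EQUIVALENT modulo the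
route's support items — bsd-cm-inert's `CccOneLowerHalf.cccOneLawOnTypeIstarZero_iff_bsdpOnType` (p415634)
over `PrintReadingsInert` (19226) + `PublishedFactsInert` (19227). Planner bsd-cm-plan's D92 package
(certified, to be applied after the K8 verdicts) retires 19226 in favour of `PlusMCEtaK` (Kobayashi 2003
§4 even main conjecture at `η` for CM good-supersingular `V`, `K_∞`-form, guard `p ≠ 2`; conjecture-grade)
+ `SignedReadingFacts` (Kitajima–Otsuki Main Thm 1.3 ∧ Kobayashi Thm 7.4 at `η`, named facts), because
hand k8i-c41 (p424110) and x1b [138] (p425824) showed the `ℚ(√p*)`-form (C1_η) binder is a dummy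
downstream. The FORWARD direction (C-cc-1 ⟹ `BSD_p`) exists in (K)-form (x1b [138]
`KFormReadings.bsdp_of_hasSignedLocalType_IstarZero_of_valuation_of_etaEvenMC`; k8i-c41
`InertBadOddEta.bsdp_of_pairValuation_of_exactReading_of_ne_two` at the pair). The CONVERSE does not:
every landed «`BSD_p` ⟹ C-cc-1» (x1b `quadraticBranchPAdicGrossZagierValuationAt_of_bsdp`, bsd-cm-inert
`quadraticBranchPAdicGrossZagierValuationAt_of_bsdp_of_readings`, k8i-c41
`pairValuation_of_bsdp_of_readings_of_ne_two`) carries `h1 : QuadraticBranchPlusMainConjectureAt V p`.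
THIS FILE supplies it:

* §1 **`pairValuation_of_bsdp_of_exactReading_of_ne_two`** — at any ODD `p`, for a twin datum and a
  generator of level `n`: `BSD(W, p)` + Poitou–Tate + GZK + (R2) + the (F)-FREE exact reading `hX`
  (k8i-c41's binder shape) + `ord_p c_p(W) = 0` ⟹ for every rational `q = #Ш_an(W)`,
  `coeff₁ L ≠ 0 ∧ v_p(coeff₁ L) = 2n + ord_p(q·Tam(W)/#W(ℚ)_tors²)`. Non-vanishing: bsd-cm-inert's
  `coeff_one_ne_zero_of_exactReading` (its `hchar` never had an (F)-antecedent); valuation: k8i-c41's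
  (F)-free exact-control value `exactControlValue_of_exactReading_of_ne_two`
  (`ord_p #Sel_str + n + ord_p(Tam/#tors²) = v`), x1b's discharged index `ord_p #Sel_str = n + ord_p #Ш[p^∞]`,
  and `BSD(W, p)`: `ord_p #Ш[p^∞] = ord_p q`.
* §2 **`quadraticBranchPAdicGrossZagierValuationAt_of_bsdp_of_exactReading`** — C-cc-1 at `(W, p)`,
  `p ≥ 5`, from `BSD(W, p)` + the (F)-free exact reading (+ `hmod hPT hGZK`, (R2)); `ord_p c_p(W) = 0` by
  x1b's `LevelBridge.padicValNat_localTamagawaNumber_eq_zero_of_quadraticTwist_signedPrime`.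
* §3 **`cccOneLawOnTypeIstarZero_of_bsdpOnType_of_plusMCEtaK`** — THE CRUX BY NAME ⟸ `BSD_p` at every
  rank-one pair of the type `(p, I₀*)`, `p ≥ 5` ∧ `hK` = the D92 item `PlusMCEtaK` VERBATIM
  (bsd-cm-plan/g15/repair/K8-19226/statement_PlusMCEtaK.txt) ∧ Kitajima–Otsuki Main Thm 1.3 (`hKO`) ∧
  Kobayashi Thm 7.4 at `η` (`h74`) ∧ `hmod hGZK hPT` — the exact reading by k8i-c41's
  `exactReadingAt_of_kobayashi74_of_plusMCEtaK`, (R2) by the typer's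
  `oddBranchStrictMinusNoFiniteSubmoduleAt_of_kitajimaOtsuki` (p420699). This is bsd-cm-inert's
  `cccOneLawOnTypeIstarZero_of_bsdpOnType` with `h₅ : PrintReadingsInert` replaced by the post-D92
  support items.
* §4 **`cccOneLawOnTypeIstarZero_iff_bsdpOnType_of_plusMCEtaK (hK : PlusMCEtaK) (hR : SignedReadingFacts)
  (h₆ : PublishedFactsInert)`** — the (K)-form twin, over the rev-4 items BY NAME, of bsd-cm-inert's
  `cccOneLawOnTypeIstarZero_iff_bsdpOnType` (what the tribunal's chip t1′ «conjunct-restatement: crux ⟺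
  `BSD_p` on the type mod own support» reads): forward = x1b [138] §4
  `KFormReadings.bsdp_of_hasSignedLocalType_IstarZero_of_valuation_of_etaEvenMC` (p425824) with `PlusMCEtaK`
  restricted from `p ≠ 2` to `5 ≤ p`, backward = §3; and the type-level consequence
  `lowerHalfOnType_of_cccOneLawOnTypeIstarZero_of_plusMCEtaK` (crux ⟹ `X12.O10.LowerHalfOnType p I₀*`, every
  `p ≥ 5`, over the rev-4 items; x1b [138] `missingLowerBoundAt_…`).
* §5 `cccOneLawOnTypeIstarZero_of_kmc_of_perrinRiou_of_plusMCEtaK` — k8i-c2's Kato–Perrin-Riou road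
  (`CccOneKMCPerrinRiou`, p430668: crux BY NAME ⟸ KMC(T_pW) ∧ PR^×(W,p) on the type) re-based from the
  aside item `PrintReadingsInert` onto the rev-4 items (§3 + p430668's reading-free §1). CONDITIONAL on the
  potss interface slots as section variables (planner D91).

HONEST LABEL: CONDITIONAL on displayed hypotheses (typed conjecture readings, named facts, `BSD_p`);
nothing is booked; no label moves; 19223 and O10-PS stay OPEN (C-cc-1 / `BSD_p` at an inert bad prime
are in no source — Kobayashi 2013, Burungale–Kobayashi–Ota 2024 need good reduction; Li–Liu–Tian need
potentially ordinary `p`). WHAT THIS IS NOT: not a proof of C-cc-1, `BSD_p`, (C1_η) or the exact reading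
anywhere; no definition, no Literature statement, no named fact minted; the crux is concluded BY NAME,
never restated. [cite: Kobayashi2003, §4 (p. 8), Thm. 7.4 (p. 13), Thm. 9.3 (p. 26)]
[cite: KitajimaOtsuki2018, Main Thm. 1.3 (arXiv:1607.03612 p. 3)] [cite: GreenbergLNM1716, §2 (pp. 62–63), §4 Lemma 4.2 (p. 102)]
[cite: MilneADT2006, Ch. I, Thm. 4.10] [cite: Miller2011LMS, §1 and Def. 1.1]
[cite: PollackRubin2004, Theorem and the remark on Sel over ℚ(μ_{p^∞}) (p. 448)]
[cite: BurnsKuriharaSano2019, Thm. 7.6 (p. 29)] [cite: Mazur1978, Cor. 4.1]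
-/

set_option autoImplicit false
set_option linter.dupNamespace false

noncomputable section

open scoped Classical MatrixGroups ModularForm NumberField

open CongruenceSubgroup Field WeierstrassCurve NumberField IsDedekindDomain IsDedekindDomain.HeightOneSpectrum
  Rat.HeightOneSpectrum
open Literature.NumberTheory.EllipticCurves
open Literature.NumberTheory.EllipticCurves.ModularForms
open Literature.NumberTheory.EllipticCurves.Rank1Residual
open Literature.NumberTheory.EllipticCurves.Rank1Residual.Typed
open Literature.NumberTheory.GaloisRepresentations Literature.NumberTheory.GaloisCohomology
open Literature.NumberTheory.EllipticCurves.IwasawaAlgebra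
open ZpExtension
open Summit.BirchSwinnertonDyer.Rank1Residual
open Summit.BirchSwinnertonDyer.Rank1Residual.Additive
open Summit.BirchSwinnertonDyer.Rank1Residual.Additive.LevelBridge
open Summit.BirchSwinnertonDyer.Rank1Residual.X12.O10
open Summit.BirchSwinnertonDyer.BirchSwinnertonDyer.Theses.InertBadSignedBranches
open Summit.BirchSwinnertonDyer.BirchSwinnertonDyer.Theorems.PrintReadingsOfLiterature
open Summit.BirchSwinnertonDyer.BirchSwinnertonDyer.Theorems.InertBadOddEta
open Summit.BirchSwinnertonDyer.BirchSwinnertonDyer.Theorems.CccOneLowerHalf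

namespace Summit.BirchSwinnertonDyer.BirchSwinnertonDyer.Theorems.CccOneKFormConverse

variable (W : WeierstrassCurve ℚ) [W.IsElliptic] [W.IsGloballyMinimal] (p : ℕ) [hp : Fact p.Prime]

/-! ## §1 Per pair, any odd `p`: the law at `(W, p)` FROM `BSD(W, p)` and the (F)-free exact reading -/

variable {p} in
/-- **The pair values of C-cc-1 FROM `BSD(W, p)`, (F)-free**, at any ODD `p`: given Poitou–Tate `hPT`,
GZK, the typed reading (R2) `hR2`, the EXACT Kobayashi-7.4 reading `hX` with NO
`QuadraticBranchPlusMainConjectureAt` antecedent, `ord_p c_p(W) = 0`, a good `a_p = 0` twin datum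
`C • W^{(p*)} = V` with its newform `f`, period scalar `ϖ` and minus branch `L`, `W(ℚ_p)[p] = 0`, a
generator `P` of `p`-divisibility level `n`, `r_an(W) = 1` and Miller's `BSD(W, p)`: for every rational
`q` with `#Ш_an(W) = q`, `coeff₁ L ≠ 0 ∧ v_p(coeff₁ L) = 2n + ord_p(q·Tam(W)/#W(ℚ)_tors²)`. The converse of
k8i-c41's `bsdp_of_pairValuation_of_exactReading_of_ne_two`; = k8i-c41's
`pairValuation_of_bsdp_of_readings_of_ne_two` with the dummy binder `h1` gone. CONDITIONAL; nothing
booked. [cite: Kobayashi2003, §4 (p. 8), Thm. 7.4 (p. 13), Thm. 9.3 (p. 26)]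
[cite: GreenbergLNM1716, §2 (pp. 62–63)] [cite: MilneADT2006, Ch. I, Thm. 4.10] [cite: Miller2011LMS, §1 and Def. 1.1] -/
theorem pairValuation_of_bsdp_of_exactReading_of_ne_two (hmod : hasEntireLFunction_rat)
    (hPT : poitouTate_selmerStructure_duality_real ℚ)
    (hGZK : rank_eq_analyticRank_of_analyticRank_le_one)
    (hR2 : OddBranchStrictMinusNoFiniteSubmoduleAt W p)
    (hX : ∀ (V : WeierstrassCurve ℚ) [V.IsElliptic] [V.IsGloballyMinimal] (C : VariableChange ℚ)
        {N : ℕ} [NeZero N] {f : CuspForm (Gamma0 N) 2},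
        p ≠ 2 → C • W.quadraticTwist ((-1) ^ (p / 2) * p) = V →
        V.HasGoodReductionAtPrime p → V.frobeniusTrace p = 0 → IsNewformOf V f →
        ∀ (ϖ : ℚ), (if Even (p / 2) then (ϖ : ℝ) * V.realPeriodRat = plusPeriod f
            else (ϖ : ℝ) * V.imaginaryPeriodRat = minusPeriod f) →
        ∀ (Lη : IwasawaAlgebra p), IsQuadraticBranchMinusLFunction f p ϖ Lη →
        ∀ (κ : ZpExtension ℚ p) (γ : Field.absoluteGaloisGroup ℚ),
          κ.IsCyclotomic → κ.IsTopGenerator γ → IsCyclotomicVariable p γ →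
        ∀ (D : StrictSignedSelmerDualData W κ ℚ_[p] γ (-1)) (L' : IwasawaAlgebra p),
          Lη = PowerSeries.X * L' → D.charIdeal = Ideal.span {L'})
    (hp2 : p ≠ 2)
    (hv0 : padicValNat p ((W.baseChange (((primesEquiv (R := 𝓞 ℚ)).symm ⟨p, hp.out⟩).adicCompletion ℚ)).localTamagawaNumber
      (((primesEquiv (R := 𝓞 ℚ)).symm ⟨p, hp.out⟩).adicCompletionIntegers ℚ)) = 0)
    {V : WeierstrassCurve ℚ} [V.IsElliptic] [V.IsGloballyMinimal] {C : VariableChange ℚ}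
    {N : ℕ} [NeZero N] {f : CuspForm (Gamma0 N) 2} {ϖ : ℚ} {L : IwasawaAlgebra p}
    {P : W.toAffine.Point} {n : ℕ}
    (hCV : C • W.quadraticTwist ((-1) ^ (p / 2) * p) = V)
    (hgood : V.HasGoodReductionAtPrime p) (hap : V.frobeniusTrace p = 0) (hf : IsNewformOf V f)
    (hϖ : if Even (p / 2) then (ϖ : ℝ) * V.realPeriodRat = plusPeriod f
        else (ϖ : ℝ) * V.imaginaryPeriodRat = minusPeriod f)
    (hL : IsQuadraticBranchMinusLFunction f p ϖ L)
    (htors : ∀ Q : (W.baseChange ℚ_[p]).toAffine.Point, p • Q = 0 → Q = 0)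
    (hP : ¬ IsOfFinAddOrder P)
    (hgen : ∀ R : W.toAffine.Point, ∃ (k : ℤ) (T : W.toAffine.Point),
      IsOfFinAddOrder T ∧ R = k • P + T)
    (hdiv : ∃ Q : (W.baseChange ℚ_[p]).toAffine.Point, p ^ n • Q = W.toPadicPoint p P)
    (hndiv : ∀ Q : (W.baseChange ℚ_[p]).toAffine.Point, p ^ (n + 1) • Q ≠ W.toPadicPoint p P)
    (hr : W.analyticRank = 1) (hB : BSDp W p) (q : ℚ) (hq : shaAn W = (q : ℂ)) :
    PowerSeries.coeff 1 L ≠ 0 ∧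
      ((PowerSeries.coeff 1 L : ℤ_[p]) : ℚ_[p]).valuation =
        2 * (n : ℤ) + padicValRat p (q * W.tamagawaProduct / (W.torsionOrder : ℚ) ^ 2) := by
  obtain ⟨-, hfin⟩ := hGZK W hr.le
  haveI : Finite W.sha := hfin
  haveI : Finite (AddCommGroup.primaryComponent W.sha p) := inferInstance
  -- `BSD(W, p)`: `ord_p q = ord_p #Ш(W)[p^∞]` (the rational `q` with `#Ш_an = q` is unique)
  obtain ⟨-, -, q', hq', hvq'⟩ := hB
  have hqq : q' = q := by exact_mod_cast hq'.symm.trans hq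
  subst hqq
  have hq0 : q' ≠ 0 := by
    rintro rfl
    exact AdditivePotMult.shaAn_ne_zero W hmod (by rw [hq', Rat.cast_zero])
  have hc : (W.tamagawaProduct : ℚ) ≠ 0 := by exact_mod_cast W.tamagawaProduct_pos_holds.ne'
  have ht : (W.torsionOrder : ℚ) ≠ 0 := by exact_mod_cast W.torsionOrder_pos_holds.ne'
  have hct : (W.tamagawaProduct : ℚ) / (W.torsionOrder : ℚ) ^ 2 ≠ 0 := div_ne_zero hc (pow_ne_zero 2 ht)
  have hsplit : padicValRat p (q' * W.tamagawaProduct / (W.torsionOrder : ℚ) ^ 2) =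
      padicValRat p q' + padicValRat p ((W.tamagawaProduct : ℚ) / (W.torsionOrder : ℚ) ^ 2) := by
    rw [mul_div_assoc, padicValRat.mul hq0 hct]
  -- non-vanishing from the exact reading (bsd-cm-inert §1; the reading has no (F)-antecedent)
  have hne : PowerSeries.coeff 1 L ≠ 0 :=
    coeff_one_ne_zero_of_exactReading W p hPT hp2 C hCV hgood hap hL hP hgen hdiv hndiv
      fun κ γ hκ hγ hγc D L' hLL' ↦ hX V C hp2 hCV hgood hap hf ϖ hϖ L hL κ γ hκ hγ hγc D L' hLL'
  -- (C3_η)'s content, (F)-free (k8i-c41): `ord_p #Sel_str + n + ord_p(Tam/#tors²) = v`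
  obtain ⟨-, hv3⟩ := exactControlValue_of_exactReading_of_ne_two W hPT hGZK hR2 hX hp2 hv0 hCV hgood hap
    hr hf hϖ hL htors hP hgen hdiv hndiv
  -- the index: `ord_p #Sel_str = n + ord_p #Ш(p)`
  have hI := (StrictSha.strictSelmerIndexAt_holds W p).padicValNat_card_eq hP hgen htors hdiv hndiv
  refine ⟨hne, ?_⟩
  rw [hI, Nat.cast_add] at hv3
  rw [hsplit, hvq']
  linarith

/-! ## §2 Per curve, `p ≥ 5`: C-cc-1 at `(W, p)` FROM `BSD(W, p)` and the (F)-free exact reading -/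

/-- **C-cc-1 at `(W, p)`, `p ≥ 5`, ⟸ `BSD(W, p)` ∧ the (F)-FREE exact reading `hX` ∧ (R2) ∧ `hmod hPT hGZK`.**
`ord_p c_p(W) = 0` is x1b's `LevelBridge.padicValNat_localTamagawaNumber_eq_zero_of_quadraticTwist_signedPrime`
(the twin is good at `p ≥ 5`: Kodaira–Néron). The (F)-free converse of x1b's pair consumer; with x1b [138]
`bsdp_of_pAdicGrossZagierValuation_of_exactReading` the two are EQUIVALENT at the pair modulo `hX`, (R2)
and named facts. CONDITIONAL; nothing booked. [cite: Kobayashi2003, §4 (p. 8), Thm. 7.4 (p. 13)]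
[cite: SilvermanAEC2009, Thm. VII.6.1 (Kodaira–Néron)] [cite: Miller2011LMS, §1 and Def. 1.1] -/
theorem quadraticBranchPAdicGrossZagierValuationAt_of_bsdp_of_exactReading (hmod : hasEntireLFunction_rat)
    (hPT : poitouTate_selmerStructure_duality_real ℚ)
    (hGZK : rank_eq_analyticRank_of_analyticRank_le_one)
    (hR2 : OddBranchStrictMinusNoFiniteSubmoduleAt W p)
    (hX : ∀ (V : WeierstrassCurve ℚ) [V.IsElliptic] [V.IsGloballyMinimal] (C : VariableChange ℚ)
        {N : ℕ} [NeZero N] {f : CuspForm (Gamma0 N) 2},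
        p ≠ 2 → C • W.quadraticTwist ((-1) ^ (p / 2) * p) = V →
        V.HasGoodReductionAtPrime p → V.frobeniusTrace p = 0 → IsNewformOf V f →
        ∀ (ϖ : ℚ), (if Even (p / 2) then (ϖ : ℝ) * V.realPeriodRat = plusPeriod f
            else (ϖ : ℝ) * V.imaginaryPeriodRat = minusPeriod f) →
        ∀ (Lη : IwasawaAlgebra p), IsQuadraticBranchMinusLFunction f p ϖ Lη →
        ∀ (κ : ZpExtension ℚ p) (γ : Field.absoluteGaloisGroup ℚ),
          κ.IsCyclotomic → κ.IsTopGenerator γ → IsCyclotomicVariable p γ →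
        ∀ (D : StrictSignedSelmerDualData W κ ℚ_[p] γ (-1)) (L' : IwasawaAlgebra p),
          Lη = PowerSeries.X * L' → D.charIdeal = Ideal.span {L'})
    (hB : BSDp W p) : QuadraticBranchPAdicGrossZagierValuationAt W p := by
  intro V _ _ C N _ f hp5 hCV hgood hap hr hf ϖ hϖ L hL htors P n hP hgen hdiv hndiv q hq
  have hp2 : p ≠ 2 := by omega
  have hv0 := padicValNat_localTamagawaNumber_eq_zero_of_quadraticTwist_signedPrime W p hp5 C V hCV hgood
  obtain ⟨hne, hv⟩ := pairValuation_of_bsdp_of_exactReading_of_ne_two W hmod hPT hGZK hR2 hX hp2 hv0 hCV hgood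
    hap hf hϖ hL htors hP hgen hdiv hndiv hr hB q hq
  exact ⟨hne, by rw [hv, add_zero]⟩

/-! ## §3 The crux BY NAME from `BSD_p` on the type over the D92 support items -/

/-- **Crux 19223 `CccOneLawOnTypeIstarZero` ⟸ `BSD(W, p)` at every rank-one pair of the signed type
`(p, I₀*)`, `p ≥ 5` ∧ the D92 item `PlusMCEtaK` VERBATIM (`hK`: Kobayashi 2003 §4 even main conjecture
at `η` for CM good-supersingular `V`, `K_∞`-form, guard `p ≠ 2` — conjecture-grade, displayed) ∧
Kitajima–Otsuki Main Thm 1.3 at `η` (`hKO`) ∧ Kobayashi Thm 7.4 at `η` (`h74`) — the two conjuncts of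
D92's `SignedReadingFacts` — ∧ `hmod hGZK hPT`** (three conjuncts of `PublishedFactsInert`). Per pair:
the exact reading by k8i-c41's `exactReadingAt_of_kobayashi74_of_plusMCEtaK` (the type supplies `W` CM),
(R2) by `oddBranchStrictMinusNoFiniteSubmoduleAt_of_kitajimaOtsuki`, then §2. = bsd-cm-inert's
`cccOneLawOnTypeIstarZero_of_bsdpOnType` with `h₅ : PrintReadingsInert` replaced by the post-D92 support
items. CONDITIONAL; nothing booked; 19223 stays OPEN. [cite: Kobayashi2003, §4 (p. 8), Thm. 7.4 (p. 13)]
[cite: KitajimaOtsuki2018, Main Thm. 1.3 (arXiv:1607.03612 p. 3)]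
[cite: PollackRubin2004, Theorem and the remark on Sel over ℚ(μ_{p^∞}) (p. 448)] -/
theorem cccOneLawOnTypeIstarZero_of_bsdpOnType_of_plusMCEtaK (hmod : hasEntireLFunction_rat)
    (hGZK : rank_eq_analyticRank_of_analyticRank_le_one)
    (hPT : poitouTate_selmerStructure_duality_real ℚ)
    (hKO : KitajimaOtsuki2018.mainThm13_etaSignedSelmerDual_noFiniteSubmodule)
    (h74 : Kobayashi2003.thm74_etaEvenMC_iff_etaOddMC)
    (hK : ∀ (p : ℕ) [Fact p.Prime], p ≠ 2 →
      ∀ (K₀ : Type) [Field K₀] [NumberField K₀] [IsCyclotomicExtension {p} ℚ K₀]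
        [(galRange (K := ℚ) K₀).Normal] (ηχ : absoluteGaloisGroup ℚ →* ℤˣ),
        (∀ σ ∈ galRange (K := ℚ) K₀, ηχ σ = 1) → ηχ ≠ 1 →
      ∀ (V : WeierstrassCurve ℚ) [V.IsElliptic] [V.IsGloballyMinimal] {N : ℕ} [NeZero N]
        {f : CuspForm (Gamma0 N) 2}, V.HasCM → V.HasGoodReductionAtPrime p → V.frobeniusTrace p = 0 →
        IsNewformOf V f →
      ∀ (ϖ : ℚ), (if Even (p / 2) then (ϖ : ℝ) * V.realPeriodRat = plusPeriod f
          else (ϖ : ℝ) * V.imaginaryPeriodRat = minusPeriod f) →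
      ∀ (κ : ZpExtension ℚ p) (γ : absoluteGaloisGroup ℚ),
        κ.IsCyclotomic → κ.IsTopGenerator γ → γ ∈ galRange (K := ℚ) K₀ → IsCyclotomicVariable p γ →
      ∀ (Lp : IwasawaAlgebra p), IsQuadraticBranchPlusLFunction f p ϖ Lp →
      ∀ D : EtaSignedSelmerDualData V κ K₀ ℚ_[p] ηχ γ 1, D.charIdeal = Ideal.span {Lp})
    (hB : ∀ (p : ℕ) [Fact p.Prime], 5 ≤ p → ∀ (W : WeierstrassCurve ℚ) [W.IsElliptic]
      [W.IsGloballyMinimal], HasSignedLocalType W p (.Istar 0) → W.analyticRank = 1 → BSDp W p) :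
    CccOneLawOnTypeIstarZero := by
  unfold CccOneLawOnTypeIstarZero
  intro p _ hp5 W _ _ hT hr
  have hp2 : p ≠ 2 := by omega
  exact quadraticBranchPAdicGrossZagierValuationAt_of_bsdp_of_exactReading W p hmod hPT hGZK
    (oddBranchStrictMinusNoFiniteSubmoduleAt_of_kitajimaOtsuki W p hKO)
    (exactReadingAt_of_kobayashi74_of_plusMCEtaK p hp2 h74
      (fun K₀ _ _ _ _ ηχ hη hη1 V _ _ N _ f hCM _ hgood hap hf ↦
        hK p hp2 K₀ ηχ hη hη1 V hCM hgood hap hf) hT)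
    (hB p hp5 W hT hr)


/-! ## §4 The crux ⟺ `BSD_p` on the type, modulo the rev-4 support items -/

/-- **THE CRUX ⟺ `BSD_p` ON THE TYPE, modulo the route's rev-4 support items** `PlusMCEtaK` (crux r3,
conjecture-grade, hypothesis), `SignedReadingFacts` (19502) and `PublishedFactsInert` (19227):
`CccOneLawOnTypeIstarZero ↔ ∀ p ≥ 5, ∀ W of signed type (p, I₀*) with r_an(W) = 1, BSDp W p`. Forward =
x1b's (K)-form pair consumer fed by `X12.O10.pairData_elim` and Mazur's period datum; backward = §3.
CONDITIONAL; nothing booked; O10-PS stays OPEN.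
[cite: Kobayashi2003, §4 (p. 8), Thm. 7.4 (p. 13), Thm. 9.3 (p. 26)] [cite: Mazur1978, Cor. 4.1]
[cite: Miller2011LMS, §1 and Def. 1.1] -/
theorem cccOneLawOnTypeIstarZero_iff_bsdpOnType_of_plusMCEtaK (hK : PlusMCEtaK) (hR : SignedReadingFacts)
    (h₆ : PublishedFactsInert) :
    CccOneLawOnTypeIstarZero ↔
      ∀ (p : ℕ) [Fact p.Prime], 5 ≤ p → ∀ (W : WeierstrassCurve ℚ) [W.IsElliptic]
        [W.IsGloballyMinimal], HasSignedLocalType W p (.Istar 0) → W.analyticRank = 1 → BSDp W p := by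
  obtain ⟨hmod, hGZ, hGZK, hPT, hnf, hM⟩ := id h₆
  refine ⟨fun h₁ p _ hp5 W _ _ hT hr ↦ ?_,
    fun hB ↦ cccOneLawOnTypeIstarZero_of_bsdpOnType_of_plusMCEtaK hmod hGZK hPT hR.1 hR.2 hK hB⟩
  exact KFormReadings.bsdp_of_hasSignedLocalType_IstarZero_of_valuation_of_etaEvenMC W p hmod hGZ hGZK hPT
    hnf hM hR.1 hR.2
    (fun p _ _hp5 K₀ _ _ _ _ ηχ hη hη1 V _ _ _N _ _f hCM hp2 ↦ hK p hp2 K₀ ηχ hη hη1 V hCM)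
    (h₁ p hp5 W hT hr) hT hr hp5

/-- **… hence, at each `p ≥ 11`, the `p`-slice of the crux ⟺ the LOWER HALF on the type** is unchanged on
rev 4: combine with bsd-cm-inert's `cccOneLawAt_iff_lowerHalfOnType_of_seven_lt` pattern — recorded here
only as the type-level consequence «crux ⟹ `X12.O10.LowerHalfOnType p I₀*` for every `p ≥ 5`» over the
rev-4 items (x1b [138] `missingLowerBoundAt_of_hasSignedLocalType_IstarZero_of_valuation_of_etaEvenMC`).
CONDITIONAL; nothing booked. [cite: Kobayashi2003, §4 (p. 8), Thm. 7.4 (p. 13)] [cite: Miller2011LMS, Def. 1.1] -/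
theorem lowerHalfOnType_of_cccOneLawOnTypeIstarZero_of_plusMCEtaK (hK : PlusMCEtaK)
    (hR : SignedReadingFacts) (h₆ : PublishedFactsInert) (h₁ : CccOneLawOnTypeIstarZero)
    (p : ℕ) [Fact p.Prime] (hp5 : 5 ≤ p) : LowerHalfOnType p (.Istar 0) := by
  obtain ⟨hmod, hGZ, hGZK, hPT, hnf, hM⟩ := id h₆
  unfold LowerHalfOnType
  intro W _ _ hT hr
  exact (KFormReadings.missingLowerBoundAt_of_hasSignedLocalType_IstarZero_of_valuation_of_etaEvenMC W p hmod
    hGZ hGZK hPT hnf hM hR.1 hR.2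
    (fun p _ _hp5 K₀ _ _ _ _ ηχ hη hη1 V _ _ _N _ _f hCM hp2 ↦ hK p hp2 K₀ ηχ hη hη1 V hCM)
    (h₁ p hp5 W hT hr) hT hr hp5).1

/-! ## §5 The Kato–Perrin-Riou road re-based on the rev-4 items -/

section KatoPerrinRiou

variable {IsOf : ∀ (W : WeierstrassCurve ℚ) [W.IsElliptic] [W.IsGloballyMinimal] (p : ℕ) [Fact p.Prime],
  KatoDescentDatum p → Prop}
variable {PRRatio : ∀ (W : WeierstrassCurve ℚ) [W.IsElliptic] [W.IsGloballyMinimal] (p : ℕ)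
  [Fact p.Prime], ℚ_[p] → Prop}
variable {KMC : ∀ (W : WeierstrassCurve ℚ) [W.IsElliptic] [W.IsGloballyMinimal] (p : ℕ), Prop}

/-- **The Kato–Perrin-Riou road on rev 4: crux 19223 BY NAME ⟸ KMC(T_pW) ∧ PR^×(W, p) at every rank-one
pair of the type `(p, I₀*)`, `p ≥ 5`** (image-free readings 1″♭/3♭ + interface lemma of cell bsd-potss)
**+ the rev-4 support items `PlusMCEtaK`, `SignedReadingFacts`, `PublishedFactsInert`** — k8i-c2's
`CccOneKMCPerrinRiou.cccOneLawOnTypeIstarZero_of_kmc_of_perrinRiou` (p430668) with the aside item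
`PrintReadingsInert` replaced (its §1 `bsdpOnType_of_kmc_of_perrinRiou` is reading-free; the conversion
`BSD_p` ⟹ C-cc-1 is §3). CONDITIONAL (potss `KMC`/`IsOf`/`PRRatio` section
variables, planner D91); nothing booked. [cite: BurnsKuriharaSano2019, Thm. 7.6 (p. 29)]
[cite: Kato2004Asterisque, Conj. 12.10 (p. 224), §15] [cite: Kobayashi2003, §4 (p. 8), Thm. 7.4 (p. 13)] -/
theorem cccOneLawOnTypeIstarZero_of_kmc_of_perrinRiou_of_plusMCEtaK
    (hC : TorsionFree.RankOneCountReading IsOf PRRatio) (hreal : TorsionFree.RealizableOfKMC IsOf KMC)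
    (hread : ReadsTrivialKMC IsOf KMC)
    (hKMC : ∀ (p : ℕ) [Fact p.Prime], 5 ≤ p → ∀ (W : WeierstrassCurve ℚ) [W.IsElliptic]
      [W.IsGloballyMinimal], HasSignedLocalType W p (.Istar 0) → W.analyticRank = 1 → KMC W p)
    (hPR : ∀ (p : ℕ) [Fact p.Prime], 5 ≤ p → ∀ (W : WeierstrassCurve ℚ) [W.IsElliptic]
      [W.IsGloballyMinimal], HasSignedLocalType W p (.Istar 0) → W.analyticRank = 1 →
      PerrinRiouUpToUnitAt PRRatio W p)
    (hK : PlusMCEtaK) (hR : SignedReadingFacts) (h₆ : PublishedFactsInert) : CccOneLawOnTypeIstarZero := by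
  obtain ⟨hmod, -, hGZK, hPT, -, -⟩ := id h₆
  exact cccOneLawOnTypeIstarZero_of_bsdpOnType_of_plusMCEtaK hmod hGZK hPT hR.1 hR.2 hK
    fun p _ hp5 W _ _ hT hr ↦ CccOneKMCPerrinRiou.bsdpOnType_of_kmc_of_perrinRiou hC hreal hread hGZK hmod
      hKMC hPR p hp5 W hT hr

end KatoPerrinRiou

end Summit.BirchSwinnertonDyer.BirchSwinnertonDyer.Theorems.CccOneKFormConverse

end
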